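import Literature.Analysis.FluidPDE.LeiZhang2011Proofs
import Literature.Analysis.FunctionSpaces.BMOJohnNirenbergLp
import Mathlib.Algebra.Order.Chebyshev
import HarnessLib

/-!
# Lei–Zhang 2011, §2: the `L⁶` oscillation of the stream function over a ball

Analysis/FluidPDE proofs file (theorems only), on the discharge path of the named fact
`Literature.Analysis.FluidPDE.LeiZhang2011_liouville` (Z. Lei, Q. S. Zhang, J. Funct. Anal. 261
(2011) = arXiv:1011.5066, Theorem 1.2 via Theorem 1.1). In the treatment of the drift term
`b₂ = ∇ × B` of the energy estimate the paper uses the John–Nirenberg inequality with `p = 6`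
(p. 7: "Taking `p = 6` in the above inequality, we have
`‖(B − B̄)f‖_{L²L²} ≤ ‖f‖_{L³L³} ‖B − B̄‖_{L⁶L⁶} ≤ ‖f‖_{L³L³} ‖B‖_{L^∞BMO} |B_R|^{1/6} R^{1/3}`").
Here the slice version for the tree's vector `BMO` seminorm: for a continuous field `B` on `ℝ³`
with `‖B‖_BMO ≤ C_B` (`eBMOSeminormVec`) and a ball `B_r = B(0,r)`, with `c` the vector of the
ball averages of the components,

`(∫_{B̄_r} (‖B − c‖²)³)^{1/3} ≤ C_J · C_B² · |B_r|^{1/3}`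

(`LeiZhang2011.exists_setIntegral_norm_sub_sq_cube_le`), the factor consumed by
`LeiZhang2011.integral_comp_mul_norm_sub_sq_mul_norm_gradient_sq_le`. Ingredients: the tree's
`exists_lintegral_ball_enorm_sub_average_rpow_le` (John–Nirenberg in `L^p`, `p = 6`) for each
component, `‖v‖² = Σ vᵢ²` and `(a + b + c)³ ≤ 9(a³ + b³ + c³)` (Mathlib's `pow_sum_le_card_mul_sum_pow`).

## References

* Z. Lei, Q. S. Zhang, J. Funct. Anal. 261 (2011) = arXiv:1011.5066, §2, p. 7 (BMOLp with
  `p = 6`). [LeiZhang2011]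
* F. John, L. Nirenberg, Comm. Pure Appl. Math. 14 (1961), (3). [JohnNirenberg1961]
-/

noncomputable section

open MeasureTheory Set Function Filter Metric
open _root_.Topology
open scoped InnerProductSpace RealInnerProductSpace NNReal ENNReal

namespace Literature.Analysis.FluidPDE

namespace LeiZhang2011

open Literature.Analysis.FunctionSpaces

/-- `‖v‖⁶ ≤ 9 Σᵢ |vᵢ|⁶` on `ℝ³`. [folklore] -/
theorem norm_pow_six_le (v : EuclideanSpace ℝ (Fin 3)) :
    ‖v‖ ^ 6 ≤ 9 * (|v 0| ^ 6 + |v 1| ^ 6 + |v 2| ^ 6) := by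
  have h2 : ‖v‖ ^ 2 = v 0 ^ 2 + v 1 ^ 2 + v 2 ^ 2 := by
    rw [EuclideanSpace.real_norm_sq_eq, Fin.sum_univ_three]
  have h6 : ‖v‖ ^ 6 = (v 0 ^ 2 + v 1 ^ 2 + v 2 ^ 2) ^ 3 := by
    rw [← h2]; ring
  rw [h6]
  -- power mean `(a + b + c)³ ≤ 9 (a³ + b³ + c³)` (Mathlib's `pow_sum_le_card_mul_sum_pow`)
  have h := pow_sum_le_card_mul_sum_pow (s := Finset.univ) (f := fun i : Fin 3 => v i ^ 2)
    (fun i _ => sq_nonneg _) 2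
  norm_num [Fin.sum_univ_three] at h
  have e : ∀ t : ℝ, (t ^ 2) ^ 3 = |t| ^ 6 := fun t => by
    rw [← sq_abs]; ring
  simpa only [e] using h

/-- **`L⁶` oscillation of a `BMO` field over a ball** (John–Nirenberg with `p = 6`, as used by
Lei–Zhang 2011, p. 7). There is an absolute constant `C_J ≥ 0` such that for every continuous
field `B` on `ℝ³` with `‖B‖_BMO ≤ C_B` (`eBMOSeminormVec`) and every `r > 0` there is a
constant vector `c` (the component-wise ball average) with
`(∫_{B̄(0,r)} (‖B − c‖²)³)^{1/3} ≤ C_J · C_B² · |B(0,r)|^{1/3}`. [cite: LeiZhang2011, §2 (arXiv p. 7), (BMOLp) with p = 6] -/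
theorem exists_setIntegral_norm_sub_sq_cube_le :
    ∃ CJ : ℝ, 0 ≤ CJ ∧ ∀ (B : EuclideanSpace ℝ (Fin 3) → EuclideanSpace ℝ (Fin 3)), Continuous B →
      ∀ (CB : ℝ≥0), eBMOSeminormVec B ≤ CB → ∀ (r : ℝ), 0 < r →
        ∃ c : EuclideanSpace ℝ (Fin 3),
          (∫ x in closedBall (0 : EuclideanSpace ℝ (Fin 3)) r, (‖B x - c‖ ^ 2) ^ (3 : ℝ)) ^ (1 / (3 : ℝ)) ≤
            CJ * (CB : ℝ) ^ 2 *
              (volume.real (ball (0 : EuclideanSpace ℝ (Fin 3)) r)) ^ (1 / (3 : ℝ)) := by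
  obtain ⟨C, hC⟩ := exists_lintegral_ball_enorm_sub_average_rpow_le
    (E := EuclideanSpace ℝ (Fin 3)) (F := ℝ) (p := 6) (by norm_num)
  refine ⟨3 * (C : ℝ) ^ (1 / (3 : ℝ)), by positivity, fun B hB CB hBMO r hr => ?_⟩
  set S : Set (EuclideanSpace ℝ (Fin 3)) := ball 0 r with hS
  -- the component averages
  set c : EuclideanSpace ℝ (Fin 3) := WithLp.toLp 2 fun i => ⨍ z in S, B z i with hc
  refine ⟨c, ?_⟩
  have hci : ∀ i, c i = ⨍ z in S, B z i := fun i => rfl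
  -- John–Nirenberg for each component
  have hvol : volume S ≠ ∞ := measure_ball_lt_top.ne
  have hcomp : ∀ i : Fin 3, ∫ x in S, |B x i - c i| ^ 6 ≤ C * (CB : ℝ) ^ 6 * volume.real S := by
    intro i
    have hfc : Continuous fun x => B x i := continuous_apply_of_continuous hB i
    have hfB : eBMOSeminorm (fun x => B x i) ≤ CB :=
      (eBMOSeminorm_apply_le_eBMOSeminormVec B i).trans hBMO
    have hmem : MemBMO (fun x => B x i) :=
      ⟨hfc.locallyIntegrable, lt_of_le_of_lt hfB ENNReal.coe_lt_top⟩
    have h := hC _ hmem 0 r hr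
    rw [← hci i] at h
    -- to real integrals
    have hint : IntegrableOn (fun x => |B x i - c i| ^ 6) S volume :=
      (((hfc.sub continuous_const).abs.pow 6).continuousOn.integrableOn_compact
        (isCompact_closedBall (0 : EuclideanSpace ℝ (Fin 3)) r)).mono_set ball_subset_closedBall
    have heq : ENNReal.ofReal (∫ x in S, |B x i - c i| ^ 6) =
        ∫⁻ x in S, ‖B x i - c i‖ₑ ^ (6 : ℝ) := by
      rw [ofReal_integral_eq_lintegral_ofReal hint (ae_of_all _ fun x => by positivity)]
      refine lintegral_congr fun x => ?_
      rw [enorm_rpow_eq_ofReal_norm_rpow _ (by norm_num), Real.norm_eq_abs,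
        show (6 : ℝ) = ((6 : ℕ) : ℝ) by norm_num, Real.rpow_natCast]
    have h2 : ENNReal.ofReal (∫ x in S, |B x i - c i| ^ 6) ≤ C * (CB : ℝ≥0∞) ^ (6 : ℝ) * volume S := by
      rw [heq]
      refine h.trans ?_
      gcongr
    have hfin : C * (CB : ℝ≥0∞) ^ (6 : ℝ) * volume S ≠ ∞ :=
      ENNReal.mul_ne_top (ENNReal.mul_ne_top ENNReal.coe_ne_top
        (ENNReal.rpow_ne_top_of_nonneg (by norm_num) ENNReal.coe_ne_top)) hvol
    have h3 := (ENNReal.ofReal_le_iff_le_toReal hfin).1 h2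
    refine h3.trans (le_of_eq ?_)
    rw [ENNReal.toReal_mul, ENNReal.toReal_mul, ENNReal.coe_toReal,
      ← ENNReal.toReal_rpow, ENNReal.coe_toReal, show (6 : ℝ) = ((6 : ℕ) : ℝ) by norm_num,
      Real.rpow_natCast]
    rfl
  -- assemble: `(‖B - c‖²)³ = ‖B - c‖⁶ ≤ 9 Σ |Bᵢ - cᵢ|⁶`
  have hptw : ∀ x, (‖B x - c‖ ^ 2) ^ (3 : ℝ) = ‖B x - c‖ ^ 6 := fun x => by
    rw [show (3 : ℝ) = ((3 : ℕ) : ℝ) by norm_num, Real.rpow_natCast]; ring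
  have hle : ∀ x, ‖B x - c‖ ^ 6 ≤
      9 * (|B x 0 - c 0| ^ 6 + |B x 1 - c 1| ^ 6 + |B x 2 - c 2| ^ 6) := fun x => by
    have h := norm_pow_six_le (B x - c)
    simpa only [PiLp.sub_apply] using h
  have hcont6 : Continuous fun x => ‖B x - c‖ ^ 6 := (hB.sub continuous_const).norm.pow 6
  have hintS : ∀ {f : EuclideanSpace ℝ (Fin 3) → ℝ}, Continuous f → IntegrableOn f S volume :=
    fun hf => (hf.continuousOn.integrableOn_compact
      (isCompact_closedBall (0 : EuclideanSpace ℝ (Fin 3)) r)).mono_set ball_subset_closedBall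
  have hI : ∫ x in closedBall (0 : EuclideanSpace ℝ (Fin 3)) r, (‖B x - c‖ ^ 2) ^ (3 : ℝ) ≤
      9 * (3 * (C * (CB : ℝ) ^ 6 * volume.real S)) := by
    rw [setIntegral_congr_set (JohnNirenberg.closedBall_ae_eq_ball (0 : EuclideanSpace ℝ (Fin 3)) hr)]
    simp_rw [hptw]
    calc ∫ x in S, ‖B x - c‖ ^ 6
        ≤ ∫ x in S, 9 * (|B x 0 - c 0| ^ 6 + |B x 1 - c 1| ^ 6 + |B x 2 - c 2| ^ 6) := by
          refine setIntegral_mono_on (hintS hcont6) (hintS ?_) measurableSet_ball fun x _ => hle x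
          have hk : ∀ i : Fin 3, Continuous fun x => |B x i - c i| ^ 6 := fun i =>
            ((continuous_apply_of_continuous hB i).sub continuous_const).abs.pow 6
          exact continuous_const.mul (((hk 0).add (hk 1)).add (hk 2))
      _ = 9 * ((∫ x in S, |B x 0 - c 0| ^ 6) + (∫ x in S, |B x 1 - c 1| ^ 6) +
            ∫ x in S, |B x 2 - c 2| ^ 6) := by
          have hk : ∀ i : Fin 3, IntegrableOn (fun x => |B x i - c i| ^ 6) S volume := fun i =>
            hintS (((continuous_apply_of_continuous hB i).sub continuous_const).abs.pow 6)
          have h01 : Integrable (fun x => |B x 0 - c 0| ^ 6 + |B x 1 - c 1| ^ 6)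
              (volume.restrict S) := (hk 0).add (hk 1)
          rw [integral_const_mul, integral_add h01 (hk 2), integral_add (hk 0) (hk 1)]
      _ ≤ 9 * (3 * (C * (CB : ℝ) ^ 6 * volume.real S)) := by
          have h0 := hcomp 0; have h1 := hcomp 1; have h2 := hcomp 2
          linarith
  -- take cube roots
  have hnonneg : 0 ≤ ∫ x in closedBall (0 : EuclideanSpace ℝ (Fin 3)) r, (‖B x - c‖ ^ 2) ^ (3 : ℝ) :=
    integral_nonneg fun x => by positivity
  have hvr : 0 ≤ volume.real S := measureReal_nonneg
  calc (∫ x in closedBall (0 : EuclideanSpace ℝ (Fin 3)) r, (‖B x - c‖ ^ 2) ^ (3 : ℝ)) ^ (1 / (3 : ℝ))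
      ≤ (27 * C * (CB : ℝ) ^ 6 * volume.real S) ^ (1 / (3 : ℝ)) := by
        refine Real.rpow_le_rpow hnonneg ?_ (by norm_num)
        linarith
    _ = 3 * (C : ℝ) ^ (1 / (3 : ℝ)) * (CB : ℝ) ^ 2 * volume.real S ^ (1 / (3 : ℝ)) := by
        rw [Real.mul_rpow (by positivity) hvr, Real.mul_rpow (by positivity) (by positivity),
          Real.mul_rpow (by norm_num) (by positivity)]
        have e27 : (27 : ℝ) ^ (1 / (3 : ℝ)) = 3 := by
          rw [show (27 : ℝ) = 3 ^ (3 : ℝ) by norm_num, ← Real.rpow_mul (by norm_num)]; norm_num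
        have e6 : ((CB : ℝ) ^ 6) ^ (1 / (3 : ℝ)) = (CB : ℝ) ^ 2 := by
          rw [← Real.rpow_natCast, ← Real.rpow_mul (NNReal.coe_nonneg _)]; norm_num
        rw [e27, e6]

end LeiZhang2011

end Literature.Analysis.FluidPDE

namespace Literature.Analysis.FluidPDE

namespace LeiZhang2011

open Literature.Analysis.FunctionSpaces

/-- **`L²` oscillation of a `BMO` field over a ball** (John–Nirenberg with `p = 2`, as used in
the proof of Lemma 3.2 of Lei–Zhang 2011, p. 9: "((BMOLp)), with `p = 2`"). There is an absolute
constant `C₂ ≥ 0` such that for every continuous field `B` on `ℝ³` with `‖B‖_BMO ≤ C_B` and every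
`r > 0` there is a constant vector `c` (the component-wise ball average) with
`∫_{B̄(0,r)} ‖B − c‖² ≤ C₂ · C_B² · |B(0,r)|`. [cite: LeiZhang2011, proof of Lemma 3.2 (arXiv p. 9), (BMOLp) with p = 2] -/
theorem exists_setIntegral_norm_sub_sq_le :
    ∃ C2 : ℝ, 0 ≤ C2 ∧ ∀ (B : EuclideanSpace ℝ (Fin 3) → EuclideanSpace ℝ (Fin 3)), Continuous B →
      ∀ (CB : ℝ≥0), eBMOSeminormVec B ≤ CB → ∀ (r : ℝ), 0 < r →
        ∃ c : EuclideanSpace ℝ (Fin 3),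
          ∫ x in closedBall (0 : EuclideanSpace ℝ (Fin 3)) r, ‖B x - c‖ ^ 2 ≤
            C2 * (CB : ℝ) ^ 2 * volume.real (ball (0 : EuclideanSpace ℝ (Fin 3)) r) := by
  obtain ⟨C, hC⟩ := exists_lintegral_ball_enorm_sub_average_rpow_le
    (E := EuclideanSpace ℝ (Fin 3)) (F := ℝ) (p := 2) (by norm_num)
  refine ⟨3 * (C : ℝ), by positivity, fun B hB CB hBMO r hr => ?_⟩
  set S : Set (EuclideanSpace ℝ (Fin 3)) := ball 0 r with hS
  set c : EuclideanSpace ℝ (Fin 3) := WithLp.toLp 2 fun i => ⨍ z in S, B z i with hc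
  refine ⟨c, ?_⟩
  have hci : ∀ i, c i = ⨍ z in S, B z i := fun i => rfl
  have hvol : volume S ≠ ∞ := measure_ball_lt_top.ne
  -- John–Nirenberg for each component
  have hcomp : ∀ i : Fin 3, ∫ x in S, |B x i - c i| ^ 2 ≤ C * (CB : ℝ) ^ 2 * volume.real S := by
    intro i
    have hfc : Continuous fun x => B x i := continuous_apply_of_continuous hB i
    have hfB : eBMOSeminorm (fun x => B x i) ≤ CB :=
      (eBMOSeminorm_apply_le_eBMOSeminormVec B i).trans hBMO
    have hmem : MemBMO (fun x => B x i) :=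
      ⟨hfc.locallyIntegrable, lt_of_le_of_lt hfB ENNReal.coe_lt_top⟩
    have h := hC _ hmem 0 r hr
    rw [← hci i] at h
    have hint : IntegrableOn (fun x => |B x i - c i| ^ 2) S volume :=
      (((hfc.sub continuous_const).abs.pow 2).continuousOn.integrableOn_compact
        (isCompact_closedBall (0 : EuclideanSpace ℝ (Fin 3)) r)).mono_set ball_subset_closedBall
    have heq : ENNReal.ofReal (∫ x in S, |B x i - c i| ^ 2) =
        ∫⁻ x in S, ‖B x i - c i‖ₑ ^ (2 : ℝ) := by
      rw [ofReal_integral_eq_lintegral_ofReal hint (ae_of_all _ fun x => by positivity)]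
      refine lintegral_congr fun x => ?_
      rw [enorm_rpow_eq_ofReal_norm_rpow _ (by norm_num), Real.norm_eq_abs,
        show (2 : ℝ) = ((2 : ℕ) : ℝ) by norm_num, Real.rpow_natCast]
    have h2 : ENNReal.ofReal (∫ x in S, |B x i - c i| ^ 2) ≤ C * (CB : ℝ≥0∞) ^ (2 : ℝ) * volume S := by
      rw [heq]
      refine h.trans ?_
      gcongr
    have hfin : C * (CB : ℝ≥0∞) ^ (2 : ℝ) * volume S ≠ ∞ :=
      ENNReal.mul_ne_top (ENNReal.mul_ne_top ENNReal.coe_ne_top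
        (ENNReal.rpow_ne_top_of_nonneg (by norm_num) ENNReal.coe_ne_top)) hvol
    have h3 := (ENNReal.ofReal_le_iff_le_toReal hfin).1 h2
    refine h3.trans (le_of_eq ?_)
    rw [ENNReal.toReal_mul, ENNReal.toReal_mul, ENNReal.coe_toReal,
      ← ENNReal.toReal_rpow, ENNReal.coe_toReal, show (2 : ℝ) = ((2 : ℕ) : ℝ) by norm_num,
      Real.rpow_natCast]
    rfl
  -- `‖B - c‖² = Σ (Bᵢ - cᵢ)²`
  have hptw : ∀ x, ‖B x - c‖ ^ 2 = |B x 0 - c 0| ^ 2 + |B x 1 - c 1| ^ 2 + |B x 2 - c 2| ^ 2 := fun x => by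
    rw [EuclideanSpace.real_norm_sq_eq, Fin.sum_univ_three]
    simp only [PiLp.sub_apply, sq_abs]
  have hintS : ∀ {f : EuclideanSpace ℝ (Fin 3) → ℝ}, Continuous f → IntegrableOn f S volume :=
    fun hf => (hf.continuousOn.integrableOn_compact
      (isCompact_closedBall (0 : EuclideanSpace ℝ (Fin 3)) r)).mono_set ball_subset_closedBall
  have hk : ∀ i : Fin 3, IntegrableOn (fun x => |B x i - c i| ^ 2) S volume := fun i =>
    hintS (((continuous_apply_of_continuous hB i).sub continuous_const).abs.pow 2)
  rw [setIntegral_congr_set (JohnNirenberg.closedBall_ae_eq_ball (0 : EuclideanSpace ℝ (Fin 3)) hr)]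
  simp_rw [hptw]
  have h01 : Integrable (fun x => |B x 0 - c 0| ^ 2 + |B x 1 - c 1| ^ 2) (volume.restrict S) :=
    (hk 0).add (hk 1)
  rw [integral_add h01 (hk 2), integral_add (hk 0) (hk 1)]
  have h0 := hcomp 0; have h1 := hcomp 1; have h2 := hcomp 2
  linarith

end LeiZhang2011

end Literature.Analysis.FluidPDE
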